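import Literature.AnabelianGeometry.EtaleTheta.SettingModelChiThetaCuspOncePunctured
import Literature.AnabelianGeometry.EtaleTheta.Discharge.Sec2InvEllOfCLevel
import Mathlib.Topology.Instances.ZMod
import HarnessLib

/-!
# [EtTh] §2 at the cusped χ-model `modelχ′`: the profinite `Π_C := Π_X ⋊_{ι̂} ℤ/2` with the GENUINE inversion —
# an inhabitant of `PiCData` at which the eigenvalue binders hιell / hιtheta of `coverDataAx` HOLD
# (consumer form) and hIx FAILS (NV record for GAP-LEDGER G-L2t10-4 / G-L2t10-3)

S. Mochizuki, *The étale theta function and its Frobenioid-theoretic manifestations*, Publ. RIMS **45**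
(2009) [EtTh], §2 p. 36 (printed 262): «`C^log` … the stack-theoretic quotient of `X^log` by the action of
`ι`», «`Π_C` … the (profinite) étale fundamental group of `C^log`», «`Gal(X/C) ≅ ℤ/2ℤ`», «`ι` … “multiplication
by `−1`” … relative to choosing the unique cusp of `X` as origin»; Prop. 2.2 (i) p. 37 («eigenvalues `−1` and
`1`»); Def. 2.1 preamble p. 35 («`I_x ⊆ D_x` isomorphically onto `Δ̄_Θ`») [cite: MochizukiEtTh2009, Def 2.1 p.36].

Cell abc-iut, layer L2, seat abc-iut-L2-t10 (gen 5; lineage of `ThetaCoversModelPiC` / `ThetaCoversAxOfSetting`;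
self-named NV row, STATUS 10:16Z). The parameter bundle `ThetaSetting.PiCData D PiC` (the profinite
`Π_C ⊇ Π_X ↠ G_K` of §2) has so far been inhabited only through abc-iut-L2-d3's `CLevelData.piCDataOf` at the
ROOT models (no cusp; (P1) not available there). This file inhabits it DIRECTLY at abc-iut-w5-d029's cusped
χ-model `ThetaSetting.modelχ′ p` (`SettingModelChiThetaCusp`: `Π_X = F̂₂ ⋊_χ G_{ℚ_p}`, synthetic toral cusp
`D_x = b^Ẑ ⋊ G_{ℚ_p}`) with the GENUINE inversion:

* `hatInvχ p : MulAut Π_X` = `σ̂ ⋊ id` (= the completed twisted inversion, `SettingModelChiCensusClauses`),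
  an involution; `hatInvActionχ p : ℤ/2 →* Aut(Π_X)`; the carrier **`PiCχ p := Π_X ⋊_{ι̂} ℤ/2`** with the
  induced (profinite) topology — instances on this NEW carrier only;
* **`piCDataχ' p : (ThetaSetting.modelχ′ p).PiCData (PiCχ p)`**: `incl := inl` (injective, closed normal range
  of index `2`), `aug := lift augHat 1` (the inversion is OVER `G_K`), `range_aug = G_K`;
* THEOREMS (consumer shapes of `PiCData.coverDataAx`, for every once-punctured parameter `e` — inhabited by
  abc-iut-w5-d111's `nonempty_oncePuncturedData_modelχ'`): **`piCDataχ'_inv_ell`** (hιell: every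
  `c ∈ Ker(Π_C ↠ G_K) ∖ Π_X` acts on `Δ̄^ell_X` by `−1` — from ONE `c₁ := ε = inr 1̄` by this lineage's
  `PiCData.inv_ell_of_one`, where `ε·inl d·ε⁻¹·inl d = inl(ι̂ d · d) ∈ inl(⁅Δ̂,Δ̂⁆⁻)` is the (R1e′) clause
  `twistedInversion_hinv_modelχ'` of p436289), **`piCDataχ'_inv_theta`** (hιtheta, by abc-iut-L6-d6's
  `inv_theta_of_inv_ell`), **`piCDataχ'_not_hIx`** (hIx FAILS at the toral cusp, `not_hIx_modelχ'`), and the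
  census headline **`exists_piCData_inv_ell_inv_theta_not_hIx`**.

READING (GAP-LEDGER G-L2t10-4 / -3): of the three printed binders of `coverDataAx`, P-C4 (hιell, hιtheta) are
JOINTLY WITNESSED IN CONSUMER FORM together with `PiCData` + `OncePuncturedData` + (P1) + a cusp; P-C3 (hIx)
fails at this model because its cusp is the synthetic TORAL one — so `coverDataAx` itself is still not
instantiated anywhere. HONEST LIMITS: semi-synthetic model, consistency evidence only; this `Π_C` is the
profinite semidirect product, NOT a tempered `Π^tp_C` (no `MuTwoSetting`/`CLevelData` is built here — that is
abc-iut-L6-d6's stage-2 map); class (b) construction under the DEFS-FREEZE (no interface clause touched, no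
`Prop` fact); nothing of [EtTh] is asserted; no side is taken on [IUTchIII] Cor. 3.12; typed ≠ proved.
-/

noncomputable section

namespace Literature.AnabelianGeometry.EtaleTheta.SettingModel

open scoped commutatorElement
open Literature.AnabelianGeometry.SemiGraphs _root_.Topology _root_.Function

variable (p : ℕ) [Fact p.Prime]

/-! ## §1. The completed inversion `ι̂ = σ̂ ⋊ id` of `Π_X = F̂₂ ⋊_χ G_{ℚ_p}` and the carrier `Π_C := Π_X ⋊_{ι̂} ℤ/2` -/

/-- **`ι̂ := σ̂ ⋊ id ∈ Aut(Π_X)`** — the completed twisted inversion (`completionAut_twistedInversion_modelχ_apply`).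
[cite: MochizukiEtTh2009, §2 p.36] -/
def hatInvχ : MulAut (PiHtχ p) :=
  SemidirectProduct.congr sigmaHatEquiv.toMulEquiv (MulEquiv.refl (GQp p)) (actHatχ_trans_sigmaHatEquiv p)

/-- [cite: MochizukiEtTh2009, §2 p.36] -/
@[simp] theorem hatInvχ_left (z : PiHtχ p) : (hatInvχ p z).left = sigmaHat z.left := rfl

/-- [cite: MochizukiEtTh2009, §2 p.36] -/
@[simp] theorem hatInvχ_right (z : PiHtχ p) : (hatInvχ p z).right = z.right := rfl

/-- `ι̂` is an involution. [cite: MochizukiEtTh2009, §2 p.36] -/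
@[simp] theorem hatInvχ_hatInvχ (z : PiHtχ p) : hatInvχ p (hatInvχ p z) = z :=
  SemidirectProduct.ext (by rw [hatInvχ_left, hatInvχ_left, sigmaHat_sigmaHat]) rfl

/-- `ι̂ · ι̂ = 1` in `Aut(Π_X)`. [cite: MochizukiEtTh2009, §2 p.36] -/
theorem hatInvχ_mul_hatInvχ : hatInvχ p * hatInvχ p = 1 := MulEquiv.ext fun z => hatInvχ_hatInvχ p z

/-- `ι̂` on the normal factor: `ι̂ (inl x) = inl (σ̂ x)`. [cite: MochizukiEtTh2009, §2 p.36] -/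
theorem hatInvχ_inl (x : F₂hatT) : hatInvχ p (SemidirectProduct.inl x) = SemidirectProduct.inl (sigmaHat x) :=
  SemidirectProduct.ext rfl rfl

/-- `ι̂` IS the completed twisted inversion of the model (`ThetaSetting.modelχ′`). [cite: MochizukiEtTh2009, §2 p.36] -/
theorem hatInvχ_eq_completionAut (z : PiHtχ p) :
    hatInvχ p z = (ThetaSetting.modelχ' p).completionAut (twistedInversionTop (chi p) (isInducing_leftRightχ p)) z :=
  (completionAut_twistedInversion_modelχ_apply p z).symm

/-- `ι̂` is continuous. [cite: MochizukiEtTh2009, §2 p.36] -/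
theorem continuous_hatInvχ : Continuous (hatInvχ p) := by
  rw [(isInducing_leftRightHatχ p).continuous_iff]
  have h : ((fun g : PiHtχ p => (g.left, g.right)) ∘ hatInvχ p) =
      Prod.map sigmaHat id ∘ fun g : PiHtχ p => (g.left, g.right) := by
    funext g; rfl
  rw [h]
  exact (sigmaHat.continuous.prodMap continuous_id).comp (isInducing_leftRightHatχ p).continuous

/-- `ι̂` is over `G_{ℚ_p}`: `augHat ∘ ι̂ = augHat`. [cite: Mochizuki2012, Rmk 1.4.1 (ii) p.28] -/
theorem augHatχ_hatInvχ (z : PiHtχ p) : augHatχ p (hatInvχ p z) = augHatχ p z := rfl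

/-- **The action `ℤ/2 → Aut(Π_X)`, generator `↦ ι̂`** (well defined since `ι̂² = 1`). [cite: MochizukiEtTh2009, §2 p.36] -/
def hatInvActionχ : Multiplicative (ZMod 2) →* MulAut (PiHtχ p) where
  toFun z := if z = 1 then 1 else hatInvχ p
  map_one' := if_pos rfl
  map_mul' a b := by
    have key : ∀ z : Multiplicative (ZMod 2), z = 1 ∨ z = Multiplicative.ofAdd 1 := by decide
    have hne : (Multiplicative.ofAdd (1 : ZMod 2)) ≠ 1 := by decide
    have hsq : Multiplicative.ofAdd (1 : ZMod 2) * Multiplicative.ofAdd 1 = 1 := by decide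
    rcases key a with rfl | rfl <;> rcases key b with rfl | rfl
    · simp
    · simp [hne]
    · simp [hne]
    · rw [hsq, if_pos rfl, if_neg hne, hatInvχ_mul_hatInvχ]

/-- The generator acts by `ι̂`. [cite: MochizukiEtTh2009, §2 p.36] -/
theorem hatInvActionχ_ofAdd_one : hatInvActionχ p (Multiplicative.ofAdd 1) = hatInvχ p := by
  change (if Multiplicative.ofAdd (1 : ZMod 2) = 1 then (1 : MulAut (PiHtχ p)) else hatInvχ p) = _
  rw [if_neg (by decide)]

/-- Every `φ(z)` is `1` or `ι̂`; in either case it is continuous and over `G_{ℚ_p}`.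
[cite: MochizukiEtTh2009, §2 p.36] -/
theorem hatInvActionχ_eq_one_or (z : Multiplicative (ZMod 2)) : hatInvActionχ p z = 1 ∨ hatInvActionχ p z = hatInvχ p := by
  have key : ∀ z : Multiplicative (ZMod 2), z = 1 ∨ z = Multiplicative.ofAdd 1 := by decide
  rcases key z with rfl | rfl
  · exact Or.inl (map_one _)
  · exact Or.inr (hatInvActionχ_ofAdd_one p)

/-- `augHat (φ(z) x) = augHat x`. [cite: Mochizuki2012, Rmk 1.4.1 (ii) p.28] -/
theorem augHatχ_hatInvActionχ (z : Multiplicative (ZMod 2)) (x : PiHtχ p) :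
    augHatχ p (hatInvActionχ p z x) = augHatχ p x := by
  rcases hatInvActionχ_eq_one_or p z with h | h <;> rw [h]
  · rfl
  · rfl

/-- **`Π_C := Π_X ⋊_{ι̂} ℤ/2`** — the model of the profinite étale fundamental group of `C^log = X^log/{ι}` at the
cusped χ-model (p. 36). A type synonym of Mathlib's semidirect product (instances below live on it only).
[cite: MochizukiEtTh2009, Def 2.1 p.36] -/
abbrev PiCχ : Type := PiHtχ p ⋊[hatInvActionχ p] Multiplicative (ZMod 2)

/-- The topology of `Π_C`: induced along `g ↦ (g.left, g.right) ∈ Π_X × ℤ/2`. [cite: MochizukiEtTh2009, Def 2.1 p.36] -/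
instance instTopologicalSpacePiCχ : TopologicalSpace (PiCχ p) :=
  TopologicalSpace.induced (fun g : PiCχ p => (g.left, g.right)) inferInstance

/-- [cite: MochizukiEtTh2009, Def 2.1 p.36] -/
theorem isInducing_leftRightCχ : IsInducing fun g : PiCχ p => (g.left, g.right) := ⟨rfl⟩

/-- The action map `(z, x) ↦ φ(z) x` is jointly continuous (`ℤ/2` discrete, `ι̂` continuous).
[cite: MochizukiEtTh2009, Def 2.1 p.36] -/
theorem continuous_hatInvActionχ_uncurry :
    Continuous fun q : Multiplicative (ZMod 2) × PiHtχ p => hatInvActionχ p q.1 q.2 := by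
  refine continuous_prod_of_discrete_left.mpr fun z => ?_
  rcases hatInvActionχ_eq_one_or p z with h | h
  · simp only [h, MulAut.one_apply]; exact continuous_id
  · simp only [h]; exact continuous_hatInvχ p

/-- `Π_C` is a topological group. [cite: MochizukiEtTh2009, Def 2.1 p.36] -/
instance instIsTopologicalGroupPiCχ : IsTopologicalGroup (PiCχ p) :=
  Semidirect.isTopologicalGroup_of_continuous_action (isInducing_leftRightCχ p) (continuous_hatInvActionχ_uncurry p)

/-- `Π_C` is compact. [cite: MochizukiEtTh2009, Def 2.1 p.36] -/
instance instCompactSpacePiCχ : CompactSpace (PiCχ p) := Semidirect.compactSpace_of (isInducing_leftRightCχ p)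

/-- `Π_C` is Hausdorff. [cite: MochizukiEtTh2009, Def 2.1 p.36] -/
instance instT2SpacePiCχ : T2Space (PiCχ p) := Semidirect.t2Space_of (isInducing_leftRightCχ p)

/-- `Π_C` is totally disconnected (profinite). [cite: MochizukiEtTh2009, Def 2.1 p.36] -/
instance instTotallyDisconnectedSpacePiCχ : TotallyDisconnectedSpace (PiCχ p) :=
  Semidirect.totallyDisconnectedSpace_of (isInducing_leftRightCχ p)

/-- `augHat ∘ φ(z) = augHat` in the form `SemidirectProduct.lift` wants (trivial second component).
[cite: Mochizuki2012, Rmk 1.4.1 (ii) p.28] -/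
theorem augHatχ_comp_hatInvActionχ (z : Multiplicative (ZMod 2)) :
    (augHatχ p).toMonoidHom.comp (hatInvActionχ p z).toMonoidHom =
      (MulAut.conj ((1 : Multiplicative (ZMod 2) →* GQp p) z)).toMonoidHom.comp (augHatχ p).toMonoidHom := by
  refine MonoidHom.ext fun x => ?_
  simp only [MonoidHom.comp_apply, MulEquiv.coe_toMonoidHom, MonoidHom.one_apply, map_one, MulAut.one_apply]
  exact augHatχ_hatInvActionχ p z x

/-- **The augmentation `Π_C → G_{ℚ_p}`**: `(x, z) ↦ augHat x` (a homomorphism because `ι̂` is over `G_{ℚ_p}`),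
continuous. [cite: MochizukiEtTh2009, Def 2.1 p.36] -/
def augCχ : PiCχ p →ₜ* GQp p where
  toMonoidHom := SemidirectProduct.lift (augHatχ p).toMonoidHom 1 (augHatχ_comp_hatInvActionχ p)
  continuous_toFun := by
    change Continuous fun g : PiCχ p =>
      SemidirectProduct.lift (augHatχ p).toMonoidHom 1 (augHatχ_comp_hatInvActionχ p) g
    have h : (fun g : PiCχ p => SemidirectProduct.lift (augHatχ p).toMonoidHom 1 (augHatχ_comp_hatInvActionχ p) g) =
        fun g => augHatχ p g.left := by
      funext g
      change (augHatχ p).toMonoidHom g.left * (1 : Multiplicative (ZMod 2) →* GQp p) g.right = _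
      rw [MonoidHom.one_apply, mul_one]
      rfl
    rw [h]
    exact (augHatχ p).continuous.comp (Semidirect.continuous_left (isInducing_leftRightCχ p))

/-- `augC (inl x) = augHat x`. [cite: MochizukiEtTh2009, Def 2.1 p.36] -/
theorem augCχ_inl (x : PiHtχ p) : augCχ p (SemidirectProduct.inl x) = augHatχ p x :=
  SemidirectProduct.lift_inl (augHatχ p).toMonoidHom 1 (augHatχ_comp_hatInvActionχ p) x

/-- `augC (x, z) = augHat x`. [cite: MochizukiEtTh2009, Def 2.1 p.36] -/
theorem augCχ_apply (g : PiCχ p) : augCχ p g = augHatχ p g.left := by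
  change (augHatχ p).toMonoidHom g.left * (1 : Multiplicative (ZMod 2) →* GQp p) g.right = _
  rw [MonoidHom.one_apply, mul_one]
  rfl

/-! ## §2. The inhabitant of `PiCData` at `modelχ′` -/

/-- **`Π_C ⊇ Π_X ↠ G_K` at the cusped χ-model, with the genuine inversion** — an inhabitant of
`ThetaSetting.PiCData (ThetaSetting.modelχ′ p) (PiCχ p)`: `incl := inl`, `aug := augCχ`.
[cite: MochizukiEtTh2009, Def 2.1 p.36] -/
def piCDataχ' : (ThetaSetting.modelχ' p).PiCData (PiCχ p) where
  incl := ⟨SemidirectProduct.inl, Semidirect.continuous_inl (isInducing_leftRightCχ p)⟩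
  incl_injective := SemidirectProduct.inl_injective
  range_normal := by
    change (SemidirectProduct.inl : PiHtχ p →* PiCχ p).range.Normal
    rw [SemidirectProduct.range_inl_eq_ker_rightHom]
    infer_instance
  index_range := by
    change (SemidirectProduct.inl : PiHtχ p →* PiCχ p).range.index = 2
    rw [SemidirectProduct.range_inl_eq_ker_rightHom, Subgroup.index_ker,
      MonoidHom.range_eq_top.mpr SemidirectProduct.rightHom_surjective, Subgroup.card_top]
    change Nat.card (ZMod 2) = 2
    exact Nat.card_zmod 2
  aug := augCχ p
  aug_incl g := augCχ_inl p g
  range_aug := by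
    change (augCχ p).toMonoidHom.range = (⊥ : IntermediateField ℚ_[p] (PadicAlgCl p)).fixingSubgroup
    rw [IntermediateField.fixingSubgroup_bot]
    refine MonoidHom.range_eq_top.mpr fun σ => ⟨SemidirectProduct.inl (SemidirectProduct.inr σ), ?_⟩
    change augCχ p (SemidirectProduct.inl (SemidirectProduct.inr σ)) = σ
    rw [augCχ_inl]
    rfl

/-- `incl = inl` on elements. [cite: MochizukiEtTh2009, Def 2.1 p.36] -/
@[simp] theorem piCDataχ'_incl_apply (x : PiHtχ p) : (piCDataχ' p).incl x = SemidirectProduct.inl x := rfl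

/-- `aug = augCχ`. [cite: MochizukiEtTh2009, Def 2.1 p.36] -/
theorem piCDataχ'_aug : (piCDataχ' p).aug = augCχ p := rfl

/-- **`ε := (1, 1̄) ∈ Π_C`** lifts the generator of `Gal(X/C)`; it is GEOMETRIC (`aug ε = 1`) and not in `Π_X`.
[cite: MochizukiEtTh2009, §2 p.36] -/
theorem inr_one_mem_ker_not_mem_PiX :
    (SemidirectProduct.inr (Multiplicative.ofAdd (1 : ZMod 2)) : PiCχ p) ∈ (piCDataχ' p).augGK.ker ∧
      (SemidirectProduct.inr (Multiplicative.ofAdd (1 : ZMod 2)) : PiCχ p) ∉ (piCDataχ' p).PiX := by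
  constructor
  · rw [(piCDataχ' p).mem_ker_augGK, piCDataχ'_aug, augCχ_apply, SemidirectProduct.left_inr, map_one]
  · rintro ⟨y, hy⟩
    have h := congrArg SemidirectProduct.rightHom hy
    change SemidirectProduct.rightHom (SemidirectProduct.inl y) =
      SemidirectProduct.rightHom (SemidirectProduct.inr (Multiplicative.ofAdd (1 : ZMod 2))) at h
    rw [SemidirectProduct.rightHom_inl, SemidirectProduct.rightHom_inr] at h
    exact absurd h (by decide)

/-- **`ε · inl x · ε⁻¹ = inl (ι̂ x)`**: conjugation by `ε` IS the completed inversion (Mathlib `inl_aut`).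
[cite: MochizukiEtTh2009, §2 p.36] -/
theorem inr_one_conj_inl (x : PiHtχ p) :
    (SemidirectProduct.inr (Multiplicative.ofAdd (1 : ZMod 2)) : PiCχ p) * SemidirectProduct.inl x *
        (SemidirectProduct.inr (Multiplicative.ofAdd (1 : ZMod 2)))⁻¹ = SemidirectProduct.inl (hatInvχ p x) := by
  have h := SemidirectProduct.inl_aut (φ := hatInvActionχ p) (Multiplicative.ofAdd (1 : ZMod 2)) x
  rw [hatInvActionχ_ofAdd_one] at h
  rw [← map_inv]
  exact h.symm

/-! ## §3. The eigenvalue binders hιell / hιtheta HOLD at `piCDataχ'`; hIx FAILS -/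

/-- **hιell HOLDS at `piCDataχ'` (consumer form)**: every `c ∈ Ker(Π_C ↠ G_K) ∖ Π_X` acts on `Δ̄^ell_X` by `−1`,
i.e. `c · d · c⁻¹ · d ∈ barTheta l` for all `d ∈ Π_X ∩ Δ_C` — from ONE `c₁ := ε` (`PiCData.inv_ell_of_one`),
where `ε · inl d · ε⁻¹ · inl d = inl (ι̂ d · d)` lies in `inl(⁅Δ̂_X, Δ̂_X⁆⁻) ⊆ barTheta l` by the (R1e′) clause
`twistedInversion_hinv_modelχ'`. [cite: MochizukiEtTh2009, Prop 2.2 (i) p.37] -/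
theorem piCDataχ'_inv_ell (l : ℕ) (e : (ThetaSetting.modelχ' p).OncePuncturedData) :
    ∀ c ∈ (piCDataχ' p).augGK.ker, c ∉ (piCDataχ' p).PiX →
      ∀ d ∈ (piCDataχ' p).PiX ⊓ (piCDataχ' p).augGK.ker, c * d * c⁻¹ * d ∈ (piCDataχ' p).barTheta l := by
  obtain ⟨hε, hεX⟩ := inr_one_mem_ker_not_mem_PiX p
  refine (piCDataχ' p).inv_ell_of_one l e hε hεX fun d hd => ?_
  rw [← (piCDataχ' p).deltaX_eq e] at hd
  obtain ⟨y, hy, rfl⟩ := hd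
  change (SemidirectProduct.inr (Multiplicative.ofAdd (1 : ZMod 2)) : PiCχ p) * SemidirectProduct.inl y *
      (SemidirectProduct.inr (Multiplicative.ofAdd (1 : ZMod 2)))⁻¹ * SemidirectProduct.inl y ∈ _
  rw [inr_one_conj_inl, ← map_inl_mul]
  · refine (piCDataχ' p).map_closure_commutator_le_barTheta l ⟨hatInvχ p y * y, ?_, rfl⟩
    rw [hatInvχ_eq_completionAut]
    exact twistedInversion_hinv_modelχ' p y hy
where
  /-- `inl (a · b) = inl a · inl b` as elements of `Π_C` (bookkeeping). [cite: MochizukiEtTh2009, Def 2.1 p.36] -/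
  map_inl_mul (a b : PiHtχ p) :
      (SemidirectProduct.inl (a * b) : PiCχ p) = SemidirectProduct.inl a * SemidirectProduct.inl b := map_mul _ a b

/-- **hιtheta HOLDS at `piCDataχ'`** (`ι` acts on `Δ̄_Θ` by `+1`), by abc-iut-L6-d6's `inv_theta_of_inv_ell`.
[cite: MochizukiEtTh2009, Prop 2.2 (i) p.37] -/
theorem piCDataχ'_inv_theta (l : ℕ) (e : (ThetaSetting.modelχ' p).OncePuncturedData) :
    ∀ c ∈ (piCDataχ' p).augGK.ker, c ∉ (piCDataχ' p).PiX →
      ∀ t ∈ (piCDataχ' p).barTheta l, c * t * c⁻¹ * t⁻¹ ∈ (piCDataχ' p).barKer l :=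
  (piCDataχ' p).inv_theta_of_inv_ell l e (piCDataχ'_inv_ell p l e)

/-- **hIx FAILS at `piCDataχ'`** for every `l ≥ 2` (the synthetic cusp of `modelχ′` is toral;
`not_hIx_modelχ'` of `SettingModelChiCensusClauses`). [cite: MochizukiEtTh2009, Def 2.1 p.35] -/
theorem piCDataχ'_not_hIx (l : ℕ) (hl : 2 ≤ l) (e : (ThetaSetting.modelχ' p).OncePuncturedData)
    (x : (ThetaSetting.modelχ' p).Pt) :
    ¬ (((piCDataχ' p).Dx x ⊓ (piCDataχ' p).augGK.ker) ⊔ (piCDataχ' p).barKer l = (piCDataχ' p).barTheta l) :=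
  not_hIx_modelχ' p l hl (piCDataχ' p) e x

/-- **CENSUS HEADLINE (G-L2t10-4 / G-L2t10-3).** At the cusped χ-model there are once-punctured parameters
`e` (abc-iut-w5-d111) and a profinite `Π_C`-bundle `I` (this file) such that the eigenvalue binders hιell and
hιtheta of `PiCData.coverDataAx` HOLD in consumer form while the inertia binder hIx FAILS (toral cusp) — for
every `l ≥ 2`. [cite: MochizukiEtTh2009, Prop 2.2 (i) p.37] -/
theorem exists_piCData_inv_ell_inv_theta_not_hIx (l : ℕ) (hl : 2 ≤ l) :
    Nonempty (ThetaSetting.modelχ' p).OncePuncturedData ∧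
    ∃ I : (ThetaSetting.modelχ' p).PiCData (PiCχ p),
      (∀ c ∈ I.augGK.ker, c ∉ I.PiX → ∀ d ∈ I.PiX ⊓ I.augGK.ker, c * d * c⁻¹ * d ∈ I.barTheta l) ∧
      (∀ c ∈ I.augGK.ker, c ∉ I.PiX → ∀ t ∈ I.barTheta l, c * t * c⁻¹ * t⁻¹ ∈ I.barKer l) ∧
      (∃ c : PiCχ p, c ∈ I.augGK.ker ∧ c ∉ I.PiX) ∧
      ∀ x : (ThetaSetting.modelχ' p).Pt, ¬ ((I.Dx x ⊓ I.augGK.ker) ⊔ I.barKer l = I.barTheta l) := by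
  obtain ⟨e⟩ := nonempty_oncePuncturedData_modelχ' p
  exact ⟨⟨e⟩, piCDataχ' p, piCDataχ'_inv_ell p l e, piCDataχ'_inv_theta p l e, ⟨_, inr_one_mem_ker_not_mem_PiX p⟩,
    fun x => piCDataχ'_not_hIx p l hl e x⟩

end Literature.AnabelianGeometry.EtaleTheta.SettingModel

end
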